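import Summits.KontsevichZagierPeriods.KontsevichZagierPeriods.Theses.HurwitzMicroSectors
import Summits.KontsevichZagierPeriods.KontsevichZagierPeriods.Theorems.HurwitzMicroSectorsNormalFormPrinciplePiBoxTransfer
import Summits.KontsevichZagierPeriods.KontsevichZagierPeriods.Theorems.HurwitzMicroSectorsNormalFormPrincipleVariants2304
import Summits.KontsevichZagierPeriods.KontsevichZagierPeriods.Theorems.HurwitzMicroSectorsNormalFormPrincipleVariants2238

/-! TTRL-lite variant V2298 of stmt-KontsevichZagierPeriods-3869

Variant V2298 = `stub_boxRigidity` (the leaf `BoxRigidity` of `NormalFormPrinciple`: two representations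
on open unit boxes with integrands of KZ's rational shape `p/q` over `ℚ` and equal values are
KZ-equivalent) with BOTH dimensions frozen, `fix m := 5; fix m' := 8`. Verdict of the attempt seat:
**open** — this file is the exact-strength certificate, not a proof of the variant. For every `K` let
`BoxVanishing K` say that a box-rational representation of dimension `K` and value `0` is a relation.
By the tree's `boxRigidityPair_iff_boxVanishingDim` (a frozen pair `(K, m₀)` is exactly
`BoxVanishing (max K m₀)`: compare with the zero representation one way, pad by unit intervals and
subtract on the common box the other way) the pair `(5, 8)` is EXACTLY **BoxVanishing 8** — Conjecture 1
of Kontsevich–Zagier for rational integrands over `ℚ` on `(0,1)⁸` with integral `0`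
(`stub_boxRigidity_var2298_iff_boxVanishing_eight`), equivalently BoxRigidity with both dimensions `≤ 8`
(`stub_boxRigidity_var2298_iff_le_eight`), hence the SAME statement as the recorded-open siblings V2232
(pair `(2, 8)`), V2334 (pair `(8, 8)`) and the swapped pair `(8, 5)` (`…_iff_var2232`, `…_iff_var2334`,
`…_iff_swap`, all by `boxRigidityPair_congr_max`). Downward it gives `BoxVanishing j` for every `j ≤ 8`
(`boxVanishing_le_eight_of_stub_boxRigidity_var2298`): already `j = 2` decides every `ℚ`-linear relation
among the box periods `∫∫_{(0,1)²} p/q` (Catalan's `G`, `π log 2`, `log² 2`, Clausen values) in favour of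
the calculus, `j = 3` the case split `ζ(3) ∈ ℚ + ℚπ²`, `j = 5` the dichotomy "`a + b·ζ(5) = 0 ⇒
[a + b/(1 − x₁⋯x₅)]` is a relation" — none has a proof in the tree or in print. Upward,
`KontsevichZagierPeriods → parent → V2298` (`stub_boxRigidity_var2298_of_statement`), so a refutation of
the variant would refute the Summit (Conjecture 1 for the tree's calculus); the tree has no invariant of
`KZ.relations` finer than `KZ.eval`. The proved two-sided frontier is `max m m' ≤ 1`
(`boxRigidity_of_le_one`, Baker). Source: M. Kontsevich, D. Zagier, *Periods* (2001), §1.2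
Conjecture 1 and rules 1)–3). Pure proof file, no definitions. -/

-- `Summit.<Summit>.<Problem>` is the tree's mandated summit-side namespace (CONVENTIONS §2); for this
-- single-conjunct summit the two coincide, so the duplicate is deliberate.
set_option linter.dupNamespace false

noncomputable section

namespace Summit.KontsevichZagierPeriods.KontsevichZagierPeriods.Theorems

open MeasureTheory Set
open Literature.NumberTheory.Transcendental Literature.NumberTheory.Transcendental.KZ
open Summit.KontsevichZagierPeriods.KontsevichZagierPeriods.Theses.HurwitzMicroSectors
open Summit.KontsevichZagierPeriods.HurwitzMicroSectors.NormalFormPrinciple.PiBox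

/-! ## The variant V2298 itself: exactly `BoxVanishing 8` -/

/-- **V2298 ⟺ `BoxVanishing 8`**: a box-rational representation on the `8`-box of value `0` is a
relation (instance `(K, m₀) = (5, 8)` of `boxRigidityPair_iff_boxVanishingDim`, `max 5 8 = 8`).
[cite: KontsevichZagier2001, §1.2 Conjecture 1] -/
theorem stub_boxRigidity_var2298_iff_boxVanishing_eight :
    (∀ (N : IntegralRep 5) (N' : IntegralRep 8), N.domain = {x | ∀ i, x i ∈ Set.Ioo (0:ℝ) 1} → N.IsRational → N'.domain = {x | ∀ i, x i ∈ Set.Ioo (0:ℝ) 1} → N'.IsRational → N.value = N'.value → Equivalent N N') ↔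
    (∀ (M : IntegralRep 8), M.domain = {x | ∀ i, x i ∈ Set.Ioo (0:ℝ) 1} →
      M.IsRational → M.value = 0 → of M ∈ relations) :=
  boxRigidityPair_iff_boxVanishingDim 5 8

/-- **V2298 ⟺ the two-sided bounded leaf `BoxRigidity(m, m' ≤ 8)`** (the honest strength of the
variant: Conjecture 1 for all pairs of rational integrands over `ℚ` on the open unit boxes of dimension
at most `8` — among these periods `π²`, …, `π⁸`, `ζ(3)`, `ζ(5)`, `ζ(7)`, `ζ(3)²`, `ζ(3)ζ(5)`, Catalan's
`G` and every multiple zeta value of weight `≤ 8`; freezing `m := 5` next to `m' := 8` loses nothing,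
by padding). [cite: KontsevichZagier2001, §1.2 Conjecture 1] -/
theorem stub_boxRigidity_var2298_iff_le_eight :
    (∀ (N : IntegralRep 5) (N' : IntegralRep 8), N.domain = {x | ∀ i, x i ∈ Set.Ioo (0:ℝ) 1} → N.IsRational → N'.domain = {x | ∀ i, x i ∈ Set.Ioo (0:ℝ) 1} → N'.IsRational → N.value = N'.value → Equivalent N N') ↔
    (∀ (m m' : ℕ) (N : IntegralRep m) (N' : IntegralRep m'), m ≤ 8 → m' ≤ 8 →
      N.domain = {x | ∀ i, x i ∈ Set.Ioo (0:ℝ) 1} → N.IsRational →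
      N'.domain = {x | ∀ i, x i ∈ Set.Ioo (0:ℝ) 1} → N'.IsRational →
      N.value = N'.value → Equivalent N N') :=
  boxRigidityPair_iff_boxRigidityLe 5 8

/-- **V2298 ⟺ the sibling V2232** (`fix_nat:m=2; fix_nat:m'=8`): both pairs have larger dimension `8`
(`boxRigidityPair_congr_max`). [cite: KontsevichZagier2001, §1.2 Conjecture 1] -/
theorem stub_boxRigidity_var2298_iff_var2232 :
    (∀ (N : IntegralRep 5) (N' : IntegralRep 8), N.domain = {x | ∀ i, x i ∈ Set.Ioo (0:ℝ) 1} → N.IsRational → N'.domain = {x | ∀ i, x i ∈ Set.Ioo (0:ℝ) 1} → N'.IsRational → N.value = N'.value → Equivalent N N') ↔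
    (∀ (N : IntegralRep 2) (N' : IntegralRep 8), N.domain = {x | ∀ i, x i ∈ Set.Ioo (0:ℝ) 1} →
      N.IsRational → N'.domain = {x | ∀ i, x i ∈ Set.Ioo (0:ℝ) 1} → N'.IsRational →
      N.value = N'.value → Equivalent N N') :=
  boxRigidityPair_congr_max (by norm_num)

/-- **V2298 ⟺ the sibling V2334** (`fix_nat:m=8; fix_nat:m'=8`, the diagonal pair of dimension `8`).
[cite: KontsevichZagier2001, §1.2 Conjecture 1] -/
theorem stub_boxRigidity_var2298_iff_var2334 :
    (∀ (N : IntegralRep 5) (N' : IntegralRep 8), N.domain = {x | ∀ i, x i ∈ Set.Ioo (0:ℝ) 1} → N.IsRational → N'.domain = {x | ∀ i, x i ∈ Set.Ioo (0:ℝ) 1} → N'.IsRational → N.value = N'.value → Equivalent N N') ↔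
    (∀ (N : IntegralRep 8) (N' : IntegralRep 8), N.domain = {x | ∀ i, x i ∈ Set.Ioo (0:ℝ) 1} →
      N.IsRational → N'.domain = {x | ∀ i, x i ∈ Set.Ioo (0:ℝ) 1} → N'.IsRational →
      N.value = N'.value → Equivalent N N') :=
  boxRigidityPair_congr_max (by norm_num)

/-- **V2298 is the same statement as the swapped pair `(8, 5)`** (again `boxRigidityPair_congr_max`;
equivalently, symmetry of `Equivalent`). [cite: KontsevichZagier2001, §1.2 Conjecture 1] -/
theorem stub_boxRigidity_var2298_iff_swap :
    (∀ (N : IntegralRep 5) (N' : IntegralRep 8), N.domain = {x | ∀ i, x i ∈ Set.Ioo (0:ℝ) 1} → N.IsRational → N'.domain = {x | ∀ i, x i ∈ Set.Ioo (0:ℝ) 1} → N'.IsRational → N.value = N'.value → Equivalent N N') ↔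
    (∀ (N : IntegralRep 8) (N' : IntegralRep 5), N.domain = {x | ∀ i, x i ∈ Set.Ioo (0:ℝ) 1} →
      N.IsRational → N'.domain = {x | ∀ i, x i ∈ Set.Ioo (0:ℝ) 1} → N'.IsRational →
      N.value = N'.value → Equivalent N N') :=
  boxRigidityPair_congr_max (by norm_num)

/-! ## Consequences downward, and the variant from above -/

/-- **V2298 ⇒ `BoxVanishing` in every dimension `j ≤ 8`** (`BoxVanishing` descends along padding,
`boxVanishingDim_mono`); in particular the dimension-`5` statement containing the `ζ(5)` dichotomy, the
dimension-`3` one containing `ζ(3) ∈ ℚ + ℚπ²` and the dimension-`2` one containing Catalan's.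
[cite: KontsevichZagier2001, §1.2 Conjecture 1] -/
theorem boxVanishing_le_eight_of_stub_boxRigidity_var2298
    (h : ∀ (N : IntegralRep 5) (N' : IntegralRep 8), N.domain = {x | ∀ i, x i ∈ Set.Ioo (0:ℝ) 1} → N.IsRational → N'.domain = {x | ∀ i, x i ∈ Set.Ioo (0:ℝ) 1} → N'.IsRational → N.value = N'.value → Equivalent N N')
    {j : ℕ} (hj : j ≤ 8) (N : IntegralRep j) (hNd : N.domain = {x | ∀ i, x i ∈ Set.Ioo (0:ℝ) 1})
    (hNr : N.IsRational) (hv : N.value = 0) : of N ∈ relations :=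
  boxVanishingDim_mono hj (stub_boxRigidity_var2298_iff_boxVanishing_eight.1 h) N hNd hNr hv

/-- **`BoxVanishing 8` alone already proves V2298** (the honest residual of the variant: whoever
settles Conjecture 1 for vanishing box-rational periods of dimension `8` settles V2298, and conversely).
[cite: KontsevichZagier2001, §1.2 Conjecture 1] -/
theorem stub_boxRigidity_var2298_of_boxVanishing_eight
    (hvan : ∀ (M : IntegralRep 8), M.domain = {x | ∀ i, x i ∈ Set.Ioo (0:ℝ) 1} → M.IsRational →
      M.value = 0 → of M ∈ relations) :
    ∀ (N : IntegralRep 5) (N' : IntegralRep 8), N.domain = {x | ∀ i, x i ∈ Set.Ioo (0:ℝ) 1} → N.IsRational → N'.domain = {x | ∀ i, x i ∈ Set.Ioo (0:ℝ) 1} → N'.IsRational → N.value = N'.value → Equivalent N N' :=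
  stub_boxRigidity_var2298_iff_boxVanishing_eight.2 hvan

/-- **The parent leaf ⇒ V2298** (specialisation `m := 5`, `m' := 8`; the converse is not claimed —
the parent is `BoxVanishing` in ALL dimensions). [cite: KontsevichZagier2001, §1.2 Conjecture 1] -/
theorem stub_boxRigidity_var2298_of_parent
    (h : ∀ (m m' : ℕ) (N : IntegralRep m) (N' : IntegralRep m'), N.domain = {x | ∀ i, x i ∈ Set.Ioo (0:ℝ) 1} → N.IsRational → N'.domain = {x | ∀ i, x i ∈ Set.Ioo (0:ℝ) 1} → N'.IsRational → N.value = N'.value → Equivalent N N') :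
    ∀ (N : IntegralRep 5) (N' : IntegralRep 8), N.domain = {x | ∀ i, x i ∈ Set.Ioo (0:ℝ) 1} → N.IsRational → N'.domain = {x | ∀ i, x i ∈ Set.Ioo (0:ℝ) 1} → N'.IsRational → N.value = N'.value → Equivalent N N' :=
  h 5 8

/-- **`KontsevichZagierPeriods ⇒ V2298`**: the variant is a special case of Conjecture 1 for the
tree's calculus (`leaves_of_statement`) — so a refutation of the variant would refute the Summit.
[cite: KontsevichZagier2001, §1.2 Conjecture 1] -/
theorem stub_boxRigidity_var2298_of_statement (h : _root_.KontsevichZagierPeriods) :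
    ∀ (N : IntegralRep 5) (N' : IntegralRep 8), N.domain = {x | ∀ i, x i ∈ Set.Ioo (0:ℝ) 1} → N.IsRational → N'.domain = {x | ∀ i, x i ∈ Set.Ioo (0:ℝ) 1} → N'.IsRational → N.value = N'.value → Equivalent N N' :=
  (leaves_of_statement h).1 5 8

end Summit.KontsevichZagierPeriods.KontsevichZagierPeriods.Theorems

end
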